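import Summits.Ventures.HSemireg.WedgeHankelNodeImagesLow
import Summits.Ventures.HSemireg.WedgeHankelDivisorKernel
import Summits.Ventures.HSemireg.WedgeHankelTranspose

/-!
# Venture HSemireg — THE MIRROR RANGE OF THE DIVISOR LAWS: for a divisor class of total order `n + 1 − k ≤ D ≤ k + 1` the Hankel rank is `n + 1 − k` (full COLUMN rank), the kernel
# has dimension `C(2n,k) − (n+1−k)·C(n,k)`, and it is STRICTLY bigger than the intersection of the node kernels — F2b's hypothesis `D ≤ n + 1 − k` is sharp

HONEST FRAMING. Part of the Lean index of the computation cell `pub-hsemireg` (seat p10 gen 17, Sunday typer «UNIFORM-IN-n»).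
Finite-dimensional EXTERIOR ALGEBRA over a field + ranks of Hankel matrices ONLY: no variety, no cohomology theory, no sheaf, no Ext group, no semiregularity map;
nothing here says that HC / HC_CM / HC_AV holds; no Literature fact is declared or used.  Custodian versions as in `WedgeHankelSiegelIdeal` (1/3) and
`WedgeKernelDuality`; the dictionary (divisor classes `Σ_i exp(λ_iΘ)·p_i(Θ)` ↦ `w_n(Σ_i expMul λ_i q_i)`) is QUOTED, never asserted.

WHAT IS IN THE TREE.  F2a `rank_hankel1_expMul_sum` (rank `= D` for `D ≤ k+1`, `D ≤ n+1−k`), F2c `rank_hankel1_expMul_sum_eq_min` (`= min(D, k+1)` for `D ≤ n+1−k`), F2b `Kr_w_expMul_sum`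
(kernel = intersection of the node kernels, `D ≤ k+1`, `D ≤ n+1−k`), D11 `rank_hankel1_symm` (`rank H_k = rank H_{n−k}`), G8 `finrank_iInf_Kr_w_expMul_add` (this seat: the node kernels are
in general position for every `D ≤ k+1`).  THIS FILE treats the MIRROR range `n + 1 − k ≤ D ≤ k + 1` (namespace `Summit.Ventures.HSemireg.Wedge.KernelDuality` continued; imports G8, F2b,
D11):
* §109 **`rank_hankel1_expMul_sum_mirror`: `rank H_k = n + 1 − k`** there (D11's symmetry + F2c in the mirror degree `n − k`, where `D ≤ n + 1 − (n−k)`); hence for EVERY `D ≤ k + 1`: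
  **`rank_hankel1_expMul_sum_of_total_le`: `rank H_k = min(D, n + 1 − k)`**, and with F2c the THREE-REGIME FORMULA `rank H_k = min(D, k+1, n+1−k)` whenever `D ≤ k+1` OR `D ≤ n+1−k`
  (`rank_hankel1_expMul_sum_eq_min₃`).
* §110 **`finrank_Kr_w_expMul_sum_of_le`: `dim Kr(univ, w_n(Σ_i expMul λ_i q_i), k) + min(D, n+1−k)·C(n,k) = C(2n,k)`** (`D ≤ k+1`; THEOREM H); and the DICHOTOMY: for `D ≤ k + 1` (names
  `k + P_i ≤ n`), **`Kr_w_expMul_sum_eq_iInf_iff`: `Kr(class) = ⋂_i Kr(node i)` ⟺ `D ≤ n + 1 − k`** — in the mirror range `D > n + 1 − k` the class kernel is STRICTLY bigger than the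
  intersection of its node kernels (`iInf_Kr_w_expMul_lt_Kr_w_sum`: by `(D − (n+1−k))·C(n,k)` dimensions, G8's count): a degree-`k` form may kill the divisor class without killing its nodes.
* §111 the image side: **`V_w_expMul_sum_eq_iSup_iff`: for `D ≤ k + 1` (`P_i ≤ k′`), `V(class, k′) = ⨆_i V(node i, k′)` ⟺ `D ≤ k′ + 1`** — F2d's hypothesis is sharp as well
  (`V_w_expMul_sum_lt_iSup`: strictly smaller for `k′ + 1 < D ≤ k + 1`).
* §112 **`rank_hankel1_expMul_sum_profile`**: for `2D ≤ n + 2` the WHOLE rank profile `k ↦ min(D, k+1, n+1−k)` (no exceptional degree), `finrank_Kr_w_expMul_sum_profile`; the same three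
  regimes on `P¹` (`rank_hankel1_expMul_sum_add_rev_mirror`, `rank_hankel1_expMul_sum_add_rev_eq_min₃`; D11 + F3c).
NOT typed here: the fourth regime `D > max(k+1, n+1−k)` (no law: the rank depends on the weights); a NAME for the class kernel in the mirror range (it depends on the class: `Ann_k(⋀^{n−k} ∧ class)`);
anything Ext-side.  Class side only; new names only.
-/

open Module

namespace Summit.Ventures.HSemireg.Wedge.KernelDuality

open Summit.Ventures.HSemireg.Wedge Summit.Ventures.HSemireg.Wedge.Kunneth Summit.Ventures.HSemireg.Wedge.Hankel
  Summit.Ventures.HSemireg.Wedge.HankelSiegel Summit.Ventures.HSemireg.Wedge.HankelSiegelIdeal Summit.Ventures.HSemireg.Wedge.KunnethKernel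
  Summit.Ventures.HSemireg.Wedge.HankelSecant Summit.Ventures.HSemireg.Wedge.HankelFrameChange Summit.Ventures.HSemireg.Wedge.HankelPureKernel

variable (K : Type*) [Field K] {n : ℕ}

/-! ## §109. The Hankel rank of a divisor class in the mirror range -/

/-- **THE MIRROR RANGE: `rank H_k(Σ_i expMul λ_i q_i) = n + 1 − k` for `n + 1 − k ≤ D ≤ k + 1`** (`k ≤ n`, distinct `λ_i`, exact orders `P_i`) — full COLUMN rank: by D11's symmetry this is the
rank in degree `n − k`, where F2c's full-ROW-rank regime applies. -/
theorem rank_hankel1_expMul_sum_mirror {k r : ℕ} (hk : k ≤ n) {lam : Fin r → K} (hlam : Function.Injective lam) {P : Fin r → ℕ} {q : Fin r → ℕ → K}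
    (hq : ∀ i j, P i < j → q i j = 0) (hqP : ∀ i, q i (P i) ≠ 0) (hDlo : n + 1 - k ≤ ∑ i, (P i + 1)) (hDk : ∑ i, (P i + 1) ≤ k + 1) :
    (hankel1 K n k (fun j => ∑ i, expMul K (lam i) (q i) j)).rank = n + 1 - k := by
  rw [HankelSecant.rank_hankel1_symm K hk, HankelFrameChange.rank_hankel1_expMul_sum_eq_min K hlam hq hqP (by omega), min_eq_right (by omega)]
  omega

/-- **`rank H_k = min(D, n + 1 − k)` for EVERY divisor class of total order `D ≤ k + 1`** (`k ≤ n`): F2a below `n + 1 − k`, the mirror law above. -/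
theorem rank_hankel1_expMul_sum_of_total_le {k r : ℕ} (hk : k ≤ n) {lam : Fin r → K} (hlam : Function.Injective lam) {P : Fin r → ℕ} {q : Fin r → ℕ → K}
    (hq : ∀ i j, P i < j → q i j = 0) (hqP : ∀ i, q i (P i) ≠ 0) (hDk : ∑ i, (P i + 1) ≤ k + 1) :
    (hankel1 K n k (fun j => ∑ i, expMul K (lam i) (q i) j)).rank = min (∑ i, (P i + 1)) (n + 1 - k) := by
  rcases le_total (∑ i, (P i + 1)) (n + 1 - k) with h | h
  · rw [min_eq_left h]; exact HankelFrameChange.rank_hankel1_expMul_sum K hlam hq hqP hDk h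
  · rw [min_eq_right h]; exact rank_hankel1_expMul_sum_mirror K hk hlam hq hqP h hDk

/-- **THE THREE-REGIME FORMULA: `rank H_k = min(D, k + 1, n + 1 − k)` whenever `D ≤ k + 1` or `D ≤ n + 1 − k`** (`k ≤ n`; the fourth regime `D > max` has no law). -/
theorem rank_hankel1_expMul_sum_eq_min₃ {k r : ℕ} (hk : k ≤ n) {lam : Fin r → K} (hlam : Function.Injective lam) {P : Fin r → ℕ} {q : Fin r → ℕ → K}
    (hq : ∀ i j, P i < j → q i j = 0) (hqP : ∀ i, q i (P i) ≠ 0) (hD : ∑ i, (P i + 1) ≤ k + 1 ∨ ∑ i, (P i + 1) ≤ n + 1 - k) :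
    (hankel1 K n k (fun j => ∑ i, expMul K (lam i) (q i) j)).rank = min (∑ i, (P i + 1)) (min (k + 1) (n + 1 - k)) := by
  rcases hD with h | h
  · rw [rank_hankel1_expMul_sum_of_total_le K hk hlam hq hqP h]
    rcases le_total (∑ i, (P i + 1)) (n + 1 - k) with h' | h'
    · rw [min_eq_left h', min_eq_left (le_min h h')]
    · rw [min_eq_right h', min_eq_right (show min (k + 1) (n + 1 - k) ≤ _ from (min_le_right _ _).trans h'), min_eq_right (by omega : n + 1 - k ≤ k + 1)]
  · rw [HankelFrameChange.rank_hankel1_expMul_sum_eq_min K hlam hq hqP h]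
    rcases le_total (∑ i, (P i + 1)) (k + 1) with h' | h'
    · rw [min_eq_left h', min_eq_left (le_min h' h)]
    · rw [min_eq_right h', min_eq_right (show min (k + 1) (n + 1 - k) ≤ _ from (min_le_left _ _).trans h'), min_eq_left (by omega : k + 1 ≤ n + 1 - k)]

/-! ## §110. The class kernel versus the intersection of the node kernels -/

/-- **`dim Kr(univ, w_n(Σ_i expMul λ_i q_i), k) + min(D, n+1−k)·C(n,k) = C(2n,k)`** for every divisor class with `D ≤ k + 1` (`k ≤ n`; THEOREM H with §109). -/
theorem finrank_Kr_w_expMul_sum_of_le {k r : ℕ} (hk : k ≤ n) {lam : Fin r → K} (hlam : Function.Injective lam) {P : Fin r → ℕ} {q : Fin r → ℕ → K}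
    (hq : ∀ i j, P i < j → q i j = 0) (hqP : ∀ i, q i (P i) ≠ 0) (hDk : ∑ i, (P i + 1) ≤ k + 1) :
    finrank K (Kr K Finset.univ (w K n n (fun j => ∑ i, expMul K (lam i) (q i) j)) k) + min (∑ i, (P i + 1)) (n + 1 - k) * n.choose k = (n + n).choose k := by
  have h := finrank_Kr_w_add_rank K (n := n) k (fun j => ∑ i, expMul K (lam i) (q i) j)
  rw [rank_hankel1_expMul_sum_of_total_le K hk hlam hq hqP hDk, Nat.mul_comm] at h
  exact h

/-- **IN THE MIRROR RANGE THE CLASS KERNEL IS STRICTLY BIGGER THAN THE INTERSECTION OF THE NODE KERNELS**: distinct `λ_i`, exact orders with `k + P_i ≤ n`, `n + 1 − k < D ≤ k + 1` ⇒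
`⋂_i Kr(univ, w_n(expMul λ_i q_i), k) < Kr(univ, w_n(Σ_i expMul λ_i q_i), k)` — by `(D − (n+1−k))·C(n,k)` dimensions (G8's count of the intersection): a degree-`k` form may kill the
divisor class without killing its nodes. -/
theorem iInf_Kr_w_expMul_lt_Kr_w_sum {k r : ℕ} {lam : Fin r → K} (hlam : Function.Injective lam) {P : Fin r → ℕ} {q : Fin r → ℕ → K}
    (hq : ∀ i j, P i < j → q i j = 0) (hqP : ∀ i, q i (P i) ≠ 0) (hkP : ∀ i, k + P i ≤ n) (hDlo : n + 1 - k < ∑ i, (P i + 1)) (hDk : ∑ i, (P i + 1) ≤ k + 1) :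
    (⨅ i, Kr K Finset.univ (w K n n (expMul K (lam i) (q i))) k) < Kr K Finset.univ (w K n n (fun j => ∑ i, expMul K (lam i) (q i) j)) k := by
  have hr : 0 < r := by
    rcases Nat.eq_zero_or_pos r with h | h
    · subst h; simp at hDlo
    · exact h
  have hk : k ≤ n := by have := hkP ⟨0, hr⟩; omega
  refine lt_of_le_of_ne (HankelFrameChange.iInf_Kr_w_le_Kr_w_sum K hr _ k) fun heq => ?_
  have h1 := finrank_iInf_Kr_w_expMul_add K hlam hq hqP hkP hDk hr
  have h2 := finrank_Kr_w_expMul_sum_of_le K hk hlam hq hqP hDk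
  rw [heq] at h1
  rw [min_eq_right (by omega : n + 1 - k ≤ ∑ i, (P i + 1))] at h2
  have hpos : 0 < n.choose k := Nat.choose_pos hk
  have : (∑ i, (P i + 1)) * n.choose k = (n + 1 - k) * n.choose k := by omega
  have := Nat.eq_of_mul_eq_mul_right hpos this
  omega

/-- **THE DICHOTOMY: for a divisor class of total order `D ≤ k + 1` (distinct nodes, `k + P_i ≤ n`), `Kr(univ, class, k) = ⋂_i Kr(univ, node i, k)` holds IF AND ONLY IF `D ≤ n + 1 − k`**
— F2b's hypothesis is exactly the range of validity of the divisor kernel law. -/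
theorem Kr_w_expMul_sum_eq_iInf_iff {k r : ℕ} (hr : 0 < r) {lam : Fin r → K} (hlam : Function.Injective lam) {P : Fin r → ℕ} {q : Fin r → ℕ → K}
    (hq : ∀ i j, P i < j → q i j = 0) (hqP : ∀ i, q i (P i) ≠ 0) (hkP : ∀ i, k + P i ≤ n) (hDk : ∑ i, (P i + 1) ≤ k + 1) :
    Kr K Finset.univ (w K n n (fun j => ∑ i, expMul K (lam i) (q i) j)) k = (⨅ i, Kr K Finset.univ (w K n n (expMul K (lam i) (q i))) k) ↔
      ∑ i, (P i + 1) ≤ n + 1 - k := by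
  constructor
  · intro h
    by_contra hlt
    exact (iInf_Kr_w_expMul_lt_Kr_w_sum K hlam hq hqP hkP (by omega) hDk).ne h.symm
  · intro h
    rw [HankelFrameChange.Kr_w_expMul_sum K hr hlam hq hqP hDk h]
    refine iInf_congr fun i => ?_
    rw [Kr_w_expMul_of_order K (lam i) (hkP i) (hq i) (hqP i)]

/-! ## §111. The image side: the class image versus the sum of the node images -/

/-- **THE DUAL DICHOTOMY: for a divisor class with distinct nodes, exact orders `P_i ≤ k′` and total order `D ≤ k + 1` (`k + k′ = n`), `V(univ, class, k′) = ⨆_i V(univ, node i, k′)` IF AND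
ONLY IF `D ≤ k′ + 1`** — F2d's hypothesis is exactly the range of validity of the divisor image law (always `≤`; for `D > k′ + 1` the class image has dimension `(k′+1)·C(n,k′)` while the
node images, independent by G8, add up to `D·C(n,k′)`). -/
theorem V_w_expMul_sum_eq_iSup_iff {k k' r : ℕ} (hkk' : k + k' = n) {lam : Fin r → K} (hlam : Function.Injective lam) {P : Fin r → ℕ} {q : Fin r → ℕ → K}
    (hq : ∀ i j, P i < j → q i j = 0) (hqP : ∀ i, q i (P i) ≠ 0) (hPk' : ∀ i, P i ≤ k') (hDk : ∑ i, (P i + 1) ≤ k + 1) :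
    V K (In n) Finset.univ (w K n n (fun j => ∑ i, expMul K (lam i) (q i) j)) k' = ⨆ i, V K (In n) Finset.univ (w K n n (expMul K (lam i) (q i))) k' ↔
      ∑ i, (P i + 1) ≤ k' + 1 := by
  constructor
  · intro h
    have h1 := congrArg (fun W : Submodule K (HT K (In n)) => finrank K W) h
    rw [finrank_iSup_V_w_expMul_eq K hkk' hlam hq hqP hPk' hDk, HankelFrameChange.finrank_V_w,
      HankelFrameChange.rank_hankel1_expMul_sum_eq_min K hlam hq hqP (by omega), ← Nat.choose_symm (show k ≤ n by omega), show n - k = k' by omega] at h1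
    have hpos : 0 < n.choose k' := Nat.choose_pos (by omega)
    have h2 : min (∑ i, (P i + 1)) (k' + 1) = ∑ i, (P i + 1) := Nat.eq_of_mul_eq_mul_left hpos (h1.trans (Nat.mul_comm _ _))
    exact (min_eq_left_iff.mp h2)
  · intro h
    exact (HankelFrameChange.V_w_expMul_sum K hlam hq hqP h (by omega)).1

/-- **… so for `k′ + 1 < D ≤ k + 1` the class image is STRICTLY smaller than the sum of its node images** (F2d's `V_w_sum_le_iSup` is always `≤`). -/
theorem V_w_expMul_sum_lt_iSup {k k' r : ℕ} (hkk' : k + k' = n) {lam : Fin r → K} (hlam : Function.Injective lam) {P : Fin r → ℕ} {q : Fin r → ℕ → K}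
    (hq : ∀ i j, P i < j → q i j = 0) (hqP : ∀ i, q i (P i) ≠ 0) (hPk' : ∀ i, P i ≤ k') (hDlo : k' + 1 < ∑ i, (P i + 1)) (hDk : ∑ i, (P i + 1) ≤ k + 1) :
    V K (In n) Finset.univ (w K n n (fun j => ∑ i, expMul K (lam i) (q i) j)) k' < ⨆ i, V K (In n) Finset.univ (w K n n (expMul K (lam i) (q i))) k' :=
  lt_of_le_of_ne (HankelFrameChange.V_w_sum_le_iSup K _ k') fun h =>
    absurd ((V_w_expMul_sum_eq_iSup_iff K hkk' hlam hq hqP hPk' hDk).mp h) (by omega)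

/-! ## §112. The whole rank profile of a small divisor class; the mirror range on `P¹` -/

/-- **THE FULL RANK PROFILE OF A SMALL DIVISOR CLASS: for `2D ≤ n + 2` (distinct nodes, exact orders) `rank H_k = min(D, k+1, n+1−k)` in EVERY degree `k ≤ n`** — the palindromic
«tent» profile with plateau `D` (no exceptional degree: `D ≤ k + 1` or `D ≤ n + 1 − k` always holds). -/
theorem rank_hankel1_expMul_sum_profile {r : ℕ} {lam : Fin r → K} (hlam : Function.Injective lam) {P : Fin r → ℕ} {q : Fin r → ℕ → K}
    (hq : ∀ i j, P i < j → q i j = 0) (hqP : ∀ i, q i (P i) ≠ 0) (hD : 2 * ∑ i, (P i + 1) ≤ n + 2) {k : ℕ} (hk : k ≤ n) :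
    (hankel1 K n k (fun j => ∑ i, expMul K (lam i) (q i) j)).rank = min (∑ i, (P i + 1)) (min (k + 1) (n + 1 - k)) :=
  rank_hankel1_expMul_sum_eq_min₃ K hk hlam hq hqP (by omega)

/-- the corresponding KERNEL DIMENSION PROFILE: `dim Kr(univ, class, k) = C(2n,k) − min(D, k+1, n+1−k)·C(n,k)` in every degree `k ≤ n` (`2D ≤ n + 2`). -/
theorem finrank_Kr_w_expMul_sum_profile {r : ℕ} {lam : Fin r → K} (hlam : Function.Injective lam) {P : Fin r → ℕ} {q : Fin r → ℕ → K}
    (hq : ∀ i j, P i < j → q i j = 0) (hqP : ∀ i, q i (P i) ≠ 0) (hD : 2 * ∑ i, (P i + 1) ≤ n + 2) {k : ℕ} (hk : k ≤ n) :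
    finrank K (Kr K Finset.univ (w K n n (fun j => ∑ i, expMul K (lam i) (q i) j)) k) + min (∑ i, (P i + 1)) (min (k + 1) (n + 1 - k)) * n.choose k =
      (n + n).choose k := by
  have h := finrank_Kr_w_add_rank K (n := n) k (fun j => ∑ i, expMul K (lam i) (q i) j)
  rw [rank_hankel1_expMul_sum_profile K hlam hq hqP hD hk, Nat.mul_comm] at h
  exact h

/-- **THE MIRROR RANGE ON `P¹`: `rank H_k(Σ_i expMul λ_i q_i + rev_n q∞) = n + 1 − k` for `n + 1 − k ≤ D ≤ k + 1`** (a node at `∞` of exact order `P∞` among the finite nodes; D11 + F3c). -/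
theorem rank_hankel1_expMul_sum_add_rev_mirror {k r : ℕ} (hk : k ≤ n) {lam : Fin r → K} (hlam : Function.Injective lam) {P : Fin r → ℕ} {q : Fin r → ℕ → K}
    (hq : ∀ i j, P i < j → q i j = 0) (hqP : ∀ i, q i (P i) ≠ 0) {Pinf : ℕ} {qinf : ℕ → K} (hqi : ∀ j, Pinf < j → qinf j = 0) (hqiP : qinf Pinf ≠ 0)
    (hDlo : n + 1 - k ≤ ∑ i, (P i + 1) + (Pinf + 1)) (hDk : ∑ i, (P i + 1) + (Pinf + 1) ≤ k + 1) :
    (hankel1 K n k (fun j => (∑ i, expMul K (lam i) (q i) j) + rev K n qinf j)).rank = n + 1 - k := by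
  rw [HankelSecant.rank_hankel1_symm K hk, HankelFrameChange.rank_hankel1_expMul_sum_add_rev_eq_min K hlam hq hqP hqi hqiP (by omega), min_eq_right (by omega)]
  omega

/-- **`rank H_k = min(D, k+1, n+1−k)` on `P¹` whenever `D ≤ k + 1` or `D ≤ n + 1 − k`** (`k ≤ n`). -/
theorem rank_hankel1_expMul_sum_add_rev_eq_min₃ {k r : ℕ} (hk : k ≤ n) {lam : Fin r → K} (hlam : Function.Injective lam) {P : Fin r → ℕ} {q : Fin r → ℕ → K}
    (hq : ∀ i j, P i < j → q i j = 0) (hqP : ∀ i, q i (P i) ≠ 0) {Pinf : ℕ} {qinf : ℕ → K} (hqi : ∀ j, Pinf < j → qinf j = 0) (hqiP : qinf Pinf ≠ 0)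
    (hD : ∑ i, (P i + 1) + (Pinf + 1) ≤ k + 1 ∨ ∑ i, (P i + 1) + (Pinf + 1) ≤ n + 1 - k) :
    (hankel1 K n k (fun j => (∑ i, expMul K (lam i) (q i) j) + rev K n qinf j)).rank = min (∑ i, (P i + 1) + (Pinf + 1)) (min (k + 1) (n + 1 - k)) := by
  rcases hD with h | h
  · rcases le_total (∑ i, (P i + 1) + (Pinf + 1)) (n + 1 - k) with h' | h'
    · rw [HankelFrameChange.rank_hankel1_expMul_sum_add_rev K hlam hq hqP hqi hqiP h h', min_eq_left (le_min h h')]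
    · rw [rank_hankel1_expMul_sum_add_rev_mirror K hk hlam hq hqP hqi hqiP h' h, min_eq_right (show min (k + 1) (n + 1 - k) ≤ _ from (min_le_right _ _).trans h'),
        min_eq_right (by omega : n + 1 - k ≤ k + 1)]
  · rw [HankelFrameChange.rank_hankel1_expMul_sum_add_rev_eq_min K hlam hq hqP hqi hqiP h]
    rcases le_total (∑ i, (P i + 1) + (Pinf + 1)) (k + 1) with h' | h'
    · rw [min_eq_left h', min_eq_left (le_min h' h)]
    · rw [min_eq_right h', min_eq_right (show min (k + 1) (n + 1 - k) ≤ _ from (min_le_left _ _).trans h'), min_eq_left (by omega : k + 1 ≤ n + 1 - k)]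

end Summit.Ventures.HSemireg.Wedge.KernelDuality
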